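import Literature.NumberTheory.Automorphic.ShimuraCurveGroupDiscrete
import Literature.NumberTheory.Automorphic.ShimuraCurveFiniteVolume
import Literature.NumberTheory.Automorphic.ShimuraCurveDegreeFormulaProofs
import Literature.NumberTheory.Automorphic.ShimuraParametrizationExistenceProofs
import Literature.NumberTheory.EllipticCurves.ModularParametrizationDegreeProofs
import HarnessLib

/-!
# A non-constant holomorphic map `X₀^D(M)(ℂ) → ℂ/Λ` has a degree (`D > 1`): proper discontinuity
# of `Γ₀^D(M)` and the fibre count of `Γ₀^D(M)τ ↦ ∫_{τ₀}^τ h (mod Λ)` for a non-zero weight-two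
# form `h` with periods in a lattice `Λ`

Topic `NumberTheory/Automorphic`; theorems only (no definition, no named fact, no instance). A
brick of the proof of the named fact
`Literature.NumberTheory.Automorphic.nonempty_shimuraParametrizationData`
(`ShimuraCurveRibetTakahashi.lean`), namely the `deg`/`deg_spec` clause of its automorphic half
(`nonempty_shimuraParametrizationData_iff_automorphicHalf`,
`ShimuraParametrizationExistenceProofs.lean`): in the printed proof (Pasten, *Shimura curves and the
abc conjecture*, Prop. 5.1 p. 17) "the `ℂ`-map `φ_{p₀} = q j_{p₀} : X₀^D(M)^{an} → A_ℂ`" is a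
non-constant holomorphic map of compact Riemann surfaces and therefore has a degree — every point
off a finite set has the same number `d ≥ 1` of preimages (Farkas–Kra, *Riemann surfaces*,
Prop. I.1.6). For a datum `X : ShimuraCurveData D M` (`ShimuraCurve.lean`):

1. `ShimuraCurveData.discreteTopology_comap_Gamma`,
   `ShimuraCurveData.properlyDiscontinuousSMul_Gamma`
   — `Γ₀^D(M) = ι(O¹)` is a discrete subgroup of `SL₂(ℝ)` (its preimage in `SL₂(ℝ)` injects
   continuously into the lattice `ι(O)`, the `ℤ`-span of an `ℝ`-basis of `M₂(ℝ)`, tree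
   `ShimuraCurveData.exists_basis_coe_span_eq`) and therefore acts PROPERLY DISCONTINUOUSLY on `ℍ`
   (Mathlib: discrete subgroups of `SL₂(ℝ)` do; Vignéras IV Thm. 1.1 (1)); orbits are then locally
   separated (`eventually_forall_smul_eq_imp`).
2. `finite_and_eventually_natCard_fiberOrbits_eq` — local constancy of the number of `Γ`-orbits in
   the fibres of an equivariant `Ψ : ℍ → ℂ/Λ` (the tree's `SL₂(ℤ)` lemma of the same name in
   `EllipticCurves/ModularParametrizationDegreeProofs.lean`, ported verbatim to subgroups of
   `GL₂(ℝ)` acting properly discontinuously).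
3. `ShimuraCurveData.exists_deg_of_hasPeriodsIn` — for `1 < D` (so that `Γ₀^D(M)∖ℍ` is compact:
   tree `ShimuraCurveData.exists_forall_exists_smul_mem_closedBall`,
   `ShimuraCurveFiniteVolume.lean`),
   a non-zero `h ∈ S₂(Γ₀^D(M))` (`CuspForm X.Gamma 2`) with periods in the lattice `Λ_L` of a
   period pair `L`, and a base point `τ₀`: there is `d ≥ 1` such that for all but finitely many
   classes `c ∈ ℂ/Λ_L` there are exactly `d` orbits `Γ₀^D(M)τ` with `∫_{τ₀}^τ h ≡ c`.
4. `automorphicHalf_of_eigenform_of_one_lt`,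
   `nonempty_shimuraParametrizationData_of_one_and_eigenform`
   — hence the `D > 1` part of the automorphic half of the fact follows from the existence of a
   non-zero eigenform with periods in the Néron lattice alone (Jacquet–Langlands + Shimura's
   construction + an isogeny, Pasten §2, §4.10–4.11), and the fact itself from that together with
   the `D = 1` automorphic half.

The proof of 3 is the tree's proof of the `D = 1` twin
`Literature.NumberTheory.EllipticCurves.ModularForms.exists_modularDegree_holds` (on `ℍ`,
`Γ₀(N)`-equivariantly) with the cusps removed: cocompactness replaces reduction theory and the
`q`-expansions at the cusps — EVERY fibre is `Γ`-equivalent into one compact ball; then local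
finiteness of the zeros of `h` (tree `finite_zeros_inter_of_isCompact`), the inverse function
theorem at non-zeros of `h = dΨ/dτ`, `Ψ = ∫_{τ₀}^τ h` (tree `exists_injOn_and_nhds_le_map`,
`hasDerivAt_segmentIntegral`), and local constancy of the orbit count off the countable
exceptional set `Ψ(zeros of h in K) + Λ_L`, whose complement in `ℂ` is connected.

## References

* H. M. Farkas, I. Kra, *Riemann Surfaces*, 2nd ed., GTM 71 (1992), Prop. I.1.6. [FarkasKra1992]
* H. Pasten, *Shimura curves and the abc conjecture*, J. Number Theory 254 (2024) =
  arXiv:1705.09251, Prop. 5.1 p. 17, §2 p. 12, §4.3 p. 14, §4.10–4.11 p. 16. [PastenShimura2024]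
* M.-F. Vignéras, *Arithmétique des algèbres de quaternions*, LNM 800 (1980), Ch. IV §1 Thm. 1.1.
  [VignerasLNM800]

## Mathlib / tree search

Tree: `ShimuraCurveData.exists_basis_coe_span_eq` (`ShimuraCurveGroupDiscrete`),
`ShimuraCurveData.exists_forall_exists_smul_mem_closedBall` (`ShimuraCurveFiniteVolume`),
`hasDerivAt_segmentIntegral`, `segmentIntegral_sub_segmentIntegral`,
`differentiableOn_segmentIntegral`, `orbitRel_mk_eq_mk_iff` (`ShimuraCurveDegreeFormulaProofs`),
`finite_fiber_inter`, `finite_zeros_inter_of_isCompact`, `exists_injOn_and_nhds_le_map`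
(`EllipticCurves/ModularParametrizationDegreeProofs`),
`nonempty_shimuraParametrizationData_of_automorphicHalf` (`ShimuraParametrizationExistenceProofs`).
Mathlib: `UpperHalfPlane.instProperlyDiscontinuousSL2RSubgroup`,
`Subgroup.properlyDiscontinuousSMul_iff`, `DiscreteTopology.of_continuous_injective`,
`Set.Countable.isConnected_compl_of_one_lt_rank`. No `ProperlyDiscontinuousSMul X.Gamma ℍ` and no
degree statement for `X.Gamma` existed
(`lean search 'ProperlyDiscontinuousSMul X.Gamma|exists_deg'`;
the tree's `ShimuraCurveData.isDiscreteSubgroup_Gamma` is the norm-ball finiteness form of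
discreteness).
-/

noncomputable section

open scoped MatrixGroups ModularForm Topology Manifold Pointwise Matrix.Norms.Elementwise
open Complex Filter Set Function
open UpperHalfPlane hiding I

namespace Literature.NumberTheory.Automorphic

open Literature.NumberTheory.EllipticCurves.ModularForms
  (finite_inter_of_forall_exists_nhds_eq finite_zeros_inter_of_isCompact finite_fiber_inter
    exists_injOn_and_nhds_le_map)

namespace ShimuraCurveData

variable {D M : ℕ} (X : ShimuraCurveData D M)

local notation "M₂ℝ" => Matrix (Fin 2) (Fin 2) ℝ

/-! ### `Γ₀^D(M)` is discrete and acts properly discontinuously on `ℍ` -/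

/-- **`Γ₀^D(M) = ι(O¹)` is a discrete subgroup of `SL₂(ℝ)`** (Vignéras IV Thm. 1.1 (1)): its
preimage in `SL₂(ℝ)` injects continuously into the discrete lattice `ι(O) ⊆ M₂(ℝ)`.
[cite: VignerasLNM800, Ch. IV §1 Thm. 1.1 (1)] -/
theorem discreteTopology_comap_Gamma :
    DiscreteTopology
      (X.Gamma.comap (Matrix.SpecialLinearGroup.toGL : SL(2, ℝ) →* GL (Fin 2) ℝ)) := by
  obtain ⟨e, he⟩ := X.exists_basis_coe_span_eq
  haveI : DiscreteTopology (Submodule.span ℤ (Set.range e)) :=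
    ZSpan.instDiscreteTopologySubtypeMemSubmoduleIntSpanRangeCoeBasisRealOfFinite e
  set Γ' := X.Gamma.comap (Matrix.SpecialLinearGroup.toGL : SL(2, ℝ) →* GL (Fin 2) ℝ) with hΓ'
  have hmem : ∀ g : Γ', ((g : SL(2, ℝ)) : M₂ℝ) ∈ Submodule.span ℤ (Set.range e) := by
    rintro ⟨g, hg⟩
    rw [Subgroup.mem_comap, Gamma, mem_normOneUnits_iff] at hg
    obtain ⟨⟨x, hx, hxg⟩, -, -⟩ := hg
    have : ((g : SL(2, ℝ)) : M₂ℝ) ∈ X.ι '' (X.O : Set X.B) := ⟨x, hx, hxg⟩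
    rw [← he] at this
    exact this
  let f : Γ' → Submodule.span ℤ (Set.range e) := fun g => ⟨((g : SL(2, ℝ)) : M₂ℝ), hmem g⟩
  have hcoe : Continuous fun g : SL(2, ℝ) => (g : M₂ℝ) := continuous_subtype_val
  have hfc : Continuous f := (hcoe.comp continuous_subtype_val).subtype_mk _
  have hfi : Function.Injective f := by
    rintro ⟨g, hg⟩ ⟨g', hg'⟩ h
    have h' : ((g : SL(2, ℝ)) : M₂ℝ) = ((g' : SL(2, ℝ)) : M₂ℝ) :=
      congrArg (fun v : Submodule.span ℤ (Set.range e) => (v : M₂ℝ)) h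
    exact Subtype.ext (Subtype.ext h')
  exact DiscreteTopology.of_continuous_injective hfc hfi

/-- **`Γ₀^D(M)` acts properly discontinuously on `ℍ`**: for compact `K, L ⊆ ℍ` only finitely many
`γ ∈ Γ₀^D(M)` have `γK ∩ L ≠ ∅` (discrete subgroups of `SL₂(ℝ)` act properly discontinuously —
Mathlib — and `Γ₀^D(M)` has determinant one). [cite: VignerasLNM800, Ch. IV §1 Thm. 1.1 (1)] -/
theorem properlyDiscontinuousSMul_Gamma : ProperlyDiscontinuousSMul X.Gamma ℍ := by
  haveI := X.discreteTopology_comap_Gamma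
  set Γ' := X.Gamma.comap (Matrix.SpecialLinearGroup.toGL : SL(2, ℝ) →* GL (Fin 2) ℝ) with hΓ'
  have hΓ : ProperlyDiscontinuousSMul Γ' ℍ := inferInstance
  simp only [Subgroup.properlyDiscontinuousSMul_iff] at hΓ ⊢
  intro K L hK hL
  refine ((hΓ hK hL).image Matrix.SpecialLinearGroup.toGL).subset ?_
  rintro g ⟨hg, hgKL⟩
  have hdet : Matrix.det (g : M₂ℝ) = 1 := by
    have h := congrArg Units.val (Subgroup.HasDetOne.det_eq hg)
    simpa using h
  set g₁ : SL(2, ℝ) := ⟨(g : M₂ℝ), hdet⟩ with hg₁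
  have h1 : (Matrix.SpecialLinearGroup.toGL g₁ : GL (Fin 2) ℝ) = g := Units.ext rfl
  refine ⟨g₁, ⟨?_, ?_⟩, h1⟩
  · show Matrix.SpecialLinearGroup.toGL g₁ ∈ X.Gamma
    rw [h1]
    exact hg
  · have h2 : g₁ • K = g • K := by
      ext τ
      simp only [Set.mem_smul_set]
      refine exists_congr fun σ => and_congr_right fun _ => ?_
      have h3 : g₁ • σ = g • σ := by
        rw [MulAction.compHom_smul_def]
        congr 1
      rw [h3]
    rw [h2]
    exact hgKL

end ShimuraCurveData

/-! ### Proper discontinuity: orbits are locally separated -/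

section ProperlyDiscontinuous

variable {Γ : Subgroup (GL (Fin 2) ℝ)}

/-- **Orbits of a properly discontinuous group are locally separated**: given `x, y ∈ ℍ`, all
pairs `(σ, σ')` close enough to `(x, y)` have the property that any `γ ∈ Γ` with `γσ = σ'`
already satisfies `γx = y` (only finitely many `γ` move a compact neighbourhood of `x` onto one of
`y`, and those with `γx ≠ y` are excluded by shrinking). [folklore] -/
theorem eventually_forall_smul_eq_imp [ProperlyDiscontinuousSMul Γ ℍ] (x y : ℍ) :
    ∀ᶠ p : ℍ × ℍ in 𝓝 (x, y), ∀ γ ∈ Γ, γ • p.1 = p.2 → γ • x = y := by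
  obtain ⟨Kx, hKx, hxKx⟩ := exists_compact_mem_nhds x
  obtain ⟨Ky, hKy, hyKy⟩ := exists_compact_mem_nhds y
  have hfin : {γ : GL (Fin 2) ℝ | γ ∈ Γ ∧ (γ • Kx ∩ Ky).Nonempty}.Finite :=
    (Subgroup.properlyDiscontinuousSMul_iff Γ).mp inferInstance hKx hKy
  set E : Set (GL (Fin 2) ℝ) := {γ | (γ ∈ Γ ∧ (γ • Kx ∩ Ky).Nonempty) ∧ γ • x ≠ y} with hE
  have hEfin : E.Finite := hfin.subset fun γ hγ ↦ hγ.1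
  have h1 : ∀ᶠ p : ℍ × ℍ in 𝓝 (x, y), ∀ γ ∈ E, γ • p.1 ≠ p.2 := by
    refine hEfin.eventually_all.mpr fun γ hγ ↦ ?_
    have hc : Continuous fun p : ℍ × ℍ ↦ (γ • p.1, p.2) :=
      (continuous_fst.const_smul γ).prodMk continuous_snd
    have hopen : IsOpen {q : ℍ × ℍ | q.1 ≠ q.2} := isOpen_ne_fun continuous_fst continuous_snd
    exact (hopen.preimage hc).mem_nhds hγ.2
  have h2 : ∀ᶠ p : ℍ × ℍ in 𝓝 (x, y), p.1 ∈ Kx ∧ p.2 ∈ Ky := by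
    rw [nhds_prod_eq]
    exact prod_mem_prod hxKx hyKy
  filter_upwards [h1, h2] with p hp1 hp2 γ hγ hγp
  by_contra hne
  exact hp1 γ ⟨⟨hγ, ⟨p.2, Set.mem_smul_set.mpr ⟨p.1, hp2.1, hγp⟩, hp2.2⟩⟩, hne⟩ hγp

end ProperlyDiscontinuous

/-! ### Fibres of an equivariant map `ℍ → ℂ/Λ`: local constancy of the number of orbits -/

section Count

variable {Γ : Subgroup (GL (Fin 2) ℝ)} {Ψ : ℍ → ℂ} {Λ : AddSubgroup ℂ}

/-- **Local constancy of the degree** for a subgroup `Γ ≤ GL₂(ℝ)` acting properly discontinuously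
on `ℍ` (the heart of "a non-constant holomorphic map of compact Riemann surfaces takes every
non-critical value the same number of times", Farkas–Kra Prop. I.1.6 — here for the map
`Γ∖ℍ → ℂ/Λ` induced by a continuous `Ψ : ℍ → ℂ` with `Ψ(γτ) ≡ Ψ(τ) (mod Λ)`, `Λ` discrete and
closed, argued on `ℍ`; the `GL₂(ℝ)` version of the tree's `SL₂(ℤ)` lemma of the same name):
suppose that near `w₀` every fibre `{Ψ ≡ w}` is `Γ`-equivalent into a fixed compact `K`, and that
at the fibre points over `w₀` in `K` the map `Ψ` is a local homeomorphism. Then the fibre over `w₀`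
consists of finitely many `Γ`-orbits, and the number of `Γ`-orbits in the fibre over `w` equals
that number for all `w` near `w₀`. [cite: FarkasKra1992, Prop. I.1.6] -/
theorem finite_and_eventually_natCard_fiberOrbits_eq [ProperlyDiscontinuousSMul Γ ℍ]
    (hΨ : Continuous Ψ)
    (hΛc : IsClosed (Λ : Set ℂ)) {r : ℝ} (hr : 0 < r) (hΛd : ∀ x ∈ Λ, ‖x‖ < r → x = 0)
    (hΨΓ : ∀ γ ∈ Γ, ∀ τ : ℍ, Ψ (γ • τ) - Ψ τ ∈ Λ) {K : Set ℍ} (hK : IsCompact K) {w₀ : ℂ}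
    (hred : ∀ᶠ w in 𝓝 w₀, ∀ τ : ℍ, Ψ τ - w ∈ Λ → ∃ γ ∈ Γ, γ • τ ∈ K)
    (hloc : ∀ τ ∈ K, Ψ τ - w₀ ∈ Λ →
      (∃ U ∈ 𝓝 τ, InjOn Ψ U) ∧ 𝓝 (Ψ τ) ≤ map Ψ (𝓝 τ)) :
    Finite {y : MulAction.orbitRel.Quotient Γ ℍ //
        ∃ τ : ℍ, Quotient.mk (MulAction.orbitRel Γ ℍ) τ = y ∧ Ψ τ - w₀ ∈ Λ} ∧
      ∀ᶠ w in 𝓝 w₀,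
        Nat.card {y : MulAction.orbitRel.Quotient Γ ℍ //
            ∃ τ : ℍ, Quotient.mk (MulAction.orbitRel Γ ℍ) τ = y ∧ Ψ τ - w ∈ Λ} =
          Nat.card {y : MulAction.orbitRel.Quotient Γ ℍ //
            ∃ τ : ℍ, Quotient.mk (MulAction.orbitRel Γ ℍ) τ = y ∧ Ψ τ - w₀ ∈ Λ} := by
  classical
  -- the orbit sets of the fibres over `w₀` (`ι`) and over a general `w` (`F w`)
  set ι := {y : MulAction.orbitRel.Quotient Γ ℍ //
    ∃ τ : ℍ, Quotient.mk (MulAction.orbitRel Γ ℍ) τ = y ∧ Ψ τ - w₀ ∈ Λ} with hι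
  -- invariance of the fibres
  have hAinv : ∀ (w : ℂ), ∀ γ ∈ Γ, ∀ τ : ℍ, Ψ τ - w ∈ Λ → Ψ (γ • τ) - w ∈ Λ := by
    intro w γ hγ τ hτ
    simpa using Λ.add_mem (hΨΓ γ hγ τ) hτ
  have hw₀ : ∀ τ : ℍ, Ψ τ - w₀ ∈ Λ → ∃ γ ∈ Γ, γ • τ ∈ K := hred.self_of_nhds
  -- (i) the fibre over `w₀` meets `K` in a finite set
  have hT : ({τ | Ψ τ - w₀ ∈ Λ} ∩ K).Finite :=
    finite_fiber_inter hΨ hr hΛd hK w₀ (fun τ hτK hτ ↦ (hloc τ hτK hτ).1) hΛc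
  -- (ii) representatives in `K` of the orbits in the fibre over `w₀`
  have hrep : ∀ y : ι, ∃ τ ∈ K, Ψ τ - w₀ ∈ Λ ∧
      Quotient.mk (MulAction.orbitRel Γ ℍ) τ = y.1 := by
    rintro ⟨y, τ', rfl, hτ'⟩
    obtain ⟨γ, hγ, hγτ⟩ := hw₀ τ' hτ'
    exact ⟨γ • τ', hγτ, hAinv _ γ hγ τ' hτ', (orbitRel_mk_eq_mk_iff _ _).mpr ⟨γ, hγ, rfl⟩⟩
  choose rep hrepK hrepA hrepmk using hrep
  have hfin : Finite ι := by
    haveI := hT.to_subtype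
    refine Finite.of_injective
      (fun y ↦ (⟨rep y, hrepA y, hrepK y⟩ : ↥({τ | Ψ τ - w₀ ∈ Λ} ∩ K))) (fun y y' h ↦ ?_)
    have h' : rep y = rep y' := congrArg Subtype.val h
    exact Subtype.ext (by rw [← hrepmk y, ← hrepmk y', h'])
  refine ⟨hfin, ?_⟩
  -- distinct representatives are `Γ`-inequivalent
  have hineq : ∀ y y' : ι, ∀ γ ∈ Γ, γ • rep y = rep y' → y = y' := by
    intro y y' γ hγ h
    apply Subtype.ext
    rw [← hrepmk y, ← hrepmk y']
    exact ((orbitRel_mk_eq_mk_iff _ _).mpr ⟨γ, hγ, h⟩).symm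
  -- (iii) neighbourhoods of the representatives
  choose U₁ hU₁ hinj using fun y : ι ↦ (hloc _ (hrepK y) (hrepA y)).1
  have hsep : ∀ y y' : ι, ∃ O ∈ 𝓝 (rep y), ∃ O' ∈ 𝓝 (rep y'), ∀ σ ∈ O, ∀ σ' ∈ O',
      ∀ γ ∈ Γ, γ • σ = σ' → γ • rep y = rep y' := by
    intro y y'
    obtain ⟨O, hO, O', hO', hsub⟩ :=
      mem_nhds_prod_iff.mp (eventually_forall_smul_eq_imp (Γ := Γ) (rep y) (rep y'))
    exact ⟨O, hO, O', hO', fun σ hσ σ' hσ' γ hγ hγσ ↦ hsub (mk_mem_prod hσ hσ') γ hγ hγσ⟩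
  choose O hO O' hO' hOO' using hsep
  set U : ι → Set ℍ := fun y ↦ ((U₁ y ∩ ⋂ y', O y y') ∩ ⋂ y', O' y' y) ∩
    Ψ ⁻¹' Metric.ball (Ψ (rep y)) (r / 2) with hU
  have hUmem : ∀ y, U y ∈ 𝓝 (rep y) := by
    intro y
    refine inter_mem (inter_mem (inter_mem (hU₁ y) ?_) ?_) ?_
    · exact iInter_mem.mpr fun y' ↦ hO y y'
    · exact iInter_mem.mpr fun y' ↦ hO' y' y
    · exact hΨ.continuousAt.preimage_mem_nhds (Metric.ball_mem_nhds _ (by positivity))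
  -- points of `U y` and `U y'` related by `Γ` force `y = y'`
  have hUsep : ∀ y y', ∀ σ ∈ U y, ∀ σ' ∈ U y', ∀ γ ∈ Γ, γ • σ = σ' → y = y' := by
    intro y y' σ hσ σ' hσ' γ hγ h
    have hσO : σ ∈ O y y' := mem_iInter.mp hσ.1.1.2 y'
    have hσ'O : σ' ∈ O' y y' := mem_iInter.mp hσ'.1.2 y
    exact hineq y y' γ hγ (hOO' y y' σ hσO σ' hσ'O γ hγ h)
  -- a fibre meets each `U y` in at most one point
  have hUuniq : ∀ y (w : ℂ), ∀ σ ∈ U y, ∀ σ' ∈ U y,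
      Ψ σ - w ∈ Λ → Ψ σ' - w ∈ Λ → σ = σ' := by
    intro y w σ hσ σ' hσ' h1 h2
    have hd : Ψ σ - Ψ σ' ∈ Λ := by simpa using Λ.sub_mem h1 h2
    have hn : ‖Ψ σ - Ψ σ'‖ < r := by
      have a : dist (Ψ σ) (Ψ (rep y)) < r / 2 := hσ.2
      have b : dist (Ψ σ') (Ψ (rep y)) < r / 2 := hσ'.2
      calc ‖Ψ σ - Ψ σ'‖ = dist (Ψ σ) (Ψ σ') := (dist_eq_norm _ _).symm
        _ ≤ dist (Ψ σ) (Ψ (rep y)) + dist (Ψ σ') (Ψ (rep y)) := dist_triangle_right _ _ _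
        _ < r / 2 + r / 2 := add_lt_add a b
        _ = r := by ring
    exact hinj y hσ.1.1.1 hσ'.1.1.1 (sub_eq_zero.mp (hΛd _ hd hn))
  -- (iv) for `w` near `w₀`, each `U y` contains a point of the fibre over `w`
  have hV : ∀ y, ∀ᶠ w in 𝓝 w₀, ∃ σ ∈ U y, Ψ σ = w + (Ψ (rep y) - w₀) := by
    intro y
    have h1 : Ψ '' U y ∈ 𝓝 (Ψ (rep y)) := (hloc _ (hrepK y) (hrepA y)).2 (image_mem_map (hUmem y))
    have h2 : Tendsto (fun w : ℂ ↦ w + (Ψ (rep y) - w₀)) (𝓝 w₀) (𝓝 (Ψ (rep y))) := by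
      have hc : Continuous fun w : ℂ ↦ w + (Ψ (rep y) - w₀) := by fun_prop
      simpa using hc.tendsto w₀
    filter_upwards [h2 h1] with w hw
    obtain ⟨σ, hσ, hσw⟩ := hw
    exact ⟨σ, hσ, hσw⟩
  -- (v) for `w` near `w₀`, no point of `K` outside `Ω = ⋃ Γ U y` lies in the fibre over `w`
  set Ω : Set ℍ := {σ | ∃ y, ∃ γ ∈ Γ, γ • σ ∈ interior (U y)} with hΩ
  have hΩopen : IsOpen Ω := by
    have : Ω = ⋃ y, ⋃ γ ∈ Γ, (γ • ·) ⁻¹' interior (U y) := by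
      ext σ; simp [hΩ]
    rw [this]
    exact isOpen_iUnion fun y ↦ isOpen_biUnion fun γ _ ↦
      isOpen_interior.preimage (continuous_const_smul γ)
  have hfar₀ : ∀ σ ∈ K \ Ω, Ψ σ - w₀ ∉ Λ := by
    rintro σ ⟨hσK, hσΩ⟩ hσA
    apply hσΩ
    set y : ι := ⟨Quotient.mk _ σ, σ, rfl, hσA⟩ with hy
    obtain ⟨γ, hγ, hγσ⟩ := (orbitRel_mk_eq_mk_iff _ _).mp (hrepmk y)
    exact ⟨y, γ, hγ, hγσ ▸ mem_interior_iff_mem_nhds.mpr (hUmem y)⟩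
  have hfar : ∀ᶠ w in 𝓝 w₀, ∀ σ ∈ K \ Ω, Ψ σ - w ∉ Λ := by
    apply (hK.diff hΩopen).eventually_forall_of_forall_eventually
    intro σ hσ
    have hopen : IsOpen {p : ℂ × ℍ | Ψ p.2 - p.1 ∉ Λ} :=
      (hΛc.preimage (by fun_prop : Continuous fun p : ℂ × ℍ ↦ Ψ p.2 - p.1)).isOpen_compl
    exact hopen.mem_nhds (hfar₀ σ hσ)
  -- (vi) the bijection `y ↦ Γ σ_y(w)` for `w` near `w₀`
  filter_upwards [hred, hfar, eventually_all.mpr hV] with w hredw hfarw hVw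
  choose σ hσU hσΨ using hVw
  have hσA : ∀ y, Ψ (σ y) - w ∈ Λ := by
    intro y
    rw [hσΨ]
    simpa using hrepA y
  refine (Nat.card_eq_of_bijective (fun y : ι ↦ (⟨Quotient.mk _ (σ y), σ y, rfl, hσA y⟩ :
    {y : MulAction.orbitRel.Quotient Γ ℍ //
      ∃ τ : ℍ, Quotient.mk (MulAction.orbitRel Γ ℍ) τ = y ∧ Ψ τ - w ∈ Λ})) ⟨?_, ?_⟩).symm
  · intro y y' h
    obtain ⟨γ, hγ, hγσ⟩ := (orbitRel_mk_eq_mk_iff _ _).mp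
      (congrArg Subtype.val h : Quotient.mk _ (σ y) = Quotient.mk _ (σ y'))
    exact (hUsep y' y (σ y') (hσU y') (σ y) (hσU y) γ hγ hγσ).symm
  · rintro ⟨yw, τ, rfl, hτ⟩
    obtain ⟨γ, hγ, hγτK⟩ := hredw τ hτ
    have hγτA : Ψ (γ • τ) - w ∈ Λ := hAinv w γ hγ τ hτ
    have hγτΩ : γ • τ ∈ Ω := by
      by_contra hn
      exact hfarw (γ • τ) ⟨hγτK, hn⟩ hγτA
    obtain ⟨y, γ', hγ', hmem⟩ := hγτΩ
    have hA' : Ψ (γ' • γ • τ) - w ∈ Λ := hAinv w γ' hγ' _ hγτA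
    have heq : γ' • γ • τ = σ y := hUuniq y w _ (interior_subset hmem) _ (hσU y) hA' (hσA y)
    refine ⟨y, Subtype.ext ((orbitRel_mk_eq_mk_iff _ _).mpr ⟨γ' * γ, Γ.mul_mem hγ' hγ, ?_⟩)⟩
    rw [mul_smul, heq]

end Count

/-! ### The degree of `Γ₀^D(M)∖ℍ → ℂ/Λ_L` for `D > 1` -/

namespace ShimuraCurveData

variable {D M : ℕ} (X : ShimuraCurveData D M)

/-- **A non-constant holomorphic map from the compact Shimura curve `X₀^D(M)(ℂ)` (`D > 1`) to a
complex torus has a degree** (Farkas–Kra Prop. I.1.6; the input "`q j_{p₀} : X₀^D(M)^{an} → A_ℂ`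
has a degree" of Pasten's Prop. 5.1): for `1 < D`, a non-zero `h ∈ S₂(Γ₀^D(M))` whose periods lie
in the lattice `Λ_L` of a period pair `L`, and a base point `τ₀`, there is `d ≥ 1` such that for
all but finitely many classes `c ∈ ℂ/Λ_L` there are exactly `d` orbits `Γ₀^D(M)τ` with
`∫_{τ₀}^τ h ≡ c (mod Λ_L)`. Proof on `ℍ` (module docstring): cocompactness and proper
discontinuity of `Γ₀^D(M)` (above; cocompactness from `ShimuraCurveFiniteVolume`), local
finiteness of the zeros of `h`,
the inverse function theorem at non-zeros of `h = dΨ/dτ`, `Ψ = ∫_{τ₀}^τ h`, and connectedness of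
the complement of the countable exceptional set `Ψ(zeros of h in K) + Λ_L`, on which the orbit
count is locally constant.
[cite: FarkasKra1992, Prop. I.1.6] [cite: PastenShimura2024, Prop. 5.1 p. 17 (proof)] -/
theorem exists_deg_of_hasPeriodsIn (hD : 1 < D) (h : CuspForm X.Gamma 2) (hh : (⇑h : ℍ → ℂ) ≠ 0)
    (L : PeriodPair) (hper : HasPeriodsIn X.Gamma h (L.lattice : Set ℂ)) (τ₀ : ℍ) :
    ∃ d : ℕ, 0 < d ∧
      {c : ℂ ⧸ L.lattice.toAddSubgroup |
        Nat.card {y : MulAction.orbitRel.Quotient X.Gamma ℍ // ∃ τ : ℍ,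
          (Quotient.mk _ τ : MulAction.orbitRel.Quotient X.Gamma ℍ) = y ∧
            ((segmentIntegral h τ₀ τ : ℂ) : ℂ ⧸ L.lattice.toAddSubgroup) = c} ≠ d}.Finite := by
  classical
  haveI := X.properlyDiscontinuousSMul_Gamma
  set Ψ : ℍ → ℂ := segmentIntegral h τ₀ with hΨdef
  set Λ : AddSubgroup ℂ := L.lattice.toAddSubgroup with hΛdef
  -- the lattice `Λ` is closed, discrete and countable
  have hΛc : IsClosed (Λ : Set ℂ) := L.isClosed_lattice
  obtain ⟨r, hr, hrΛ⟩ : ∃ r > 0, ∀ x ∈ Λ, ‖x‖ < r → x = 0 := by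
    obtain ⟨ε, hε, hball⟩ := Metric.exists_ball_inter_eq_singleton_of_mem_discrete
      (isDiscrete_iff_discreteTopology.mpr (inferInstance : DiscreteTopology L.lattice))
      (zero_mem L.lattice)
    refine ⟨ε, hε, fun x hx hxn ↦ ?_⟩
    have : x ∈ Metric.ball (0 : ℂ) ε ∩ (L.lattice : Set ℂ) := ⟨by simpa using hxn, hx⟩
    rw [hball] at this
    exact this
  have hΛcount : (Λ : Set ℂ).Countable := by
    have : Countable L.lattice := Countable.of_equiv _ L.latticeEquivProd.toEquiv.symm
    exact Set.countable_coe_iff.mp this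
  -- `Ψ` is `Γ`-equivariant modulo `Λ`, holomorphic with `Ψ' = h`, continuous
  have hΨΓ : ∀ γ ∈ X.Gamma, ∀ τ : ℍ, Ψ (γ • τ) - Ψ τ ∈ Λ := by
    intro γ hγ τ
    rw [hΨdef, segmentIntegral_sub_segmentIntegral h τ₀ τ (γ • τ)]
    exact hper γ hγ τ
  have hderiv : ∀ z : ℂ, 0 < z.im → HasDerivAt (Ψ ∘ ofComplex) (h (ofComplex z)) z :=
    fun z hz ↦ hasDerivAt_segmentIntegral h τ₀ hz
  have hdiff : DifferentiableOn ℂ (Ψ ∘ ofComplex) {z : ℂ | 0 < z.im} :=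
    differentiableOn_segmentIntegral h τ₀
  have hΨc : Continuous Ψ := by
    have h2 : Ψ = (Ψ ∘ ofComplex) ∘ ((↑) : ℍ → ℂ) := by
      funext τ; simp [ofComplex_apply]
    rw [h2]
    exact hdiff.continuousOn.comp_continuous continuous_coe fun τ ↦ τ.im_pos
  -- local inverse at the non-zeros of `h`
  have hloc : ∀ τ : ℍ, h τ ≠ 0 → (∃ U ∈ 𝓝 τ, InjOn Ψ U) ∧ 𝓝 (Ψ τ) ≤ map Ψ (𝓝 τ) := by
    intro τ hτ
    refine exists_injOn_and_nhds_le_map hdiff (hderiv τ τ.im_pos) ?_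
    rwa [ofComplex_apply]
  -- cocompactness: one compact ball `K` meeting every orbit (`D > 1`)
  obtain ⟨ρ, hρ⟩ := X.exists_forall_exists_smul_mem_closedBall hD
  set K : Set ℍ := Metric.closedBall UpperHalfPlane.I ρ with hKdef
  have hK : IsCompact K := isCompact_closedBall _ _
  have hKcov : ∀ τ : ℍ, ∃ γ ∈ X.Gamma, γ • τ ∈ K := hρ
  -- the zeros of `h` in `K` and the exceptional set
  have hZfin : ({τ : ℍ | h τ = 0} ∩ K).Finite :=
    finite_zeros_inter_of_isCompact (CuspFormClass.holo h) hh hK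
  set F₁ : Set ℂ := Ψ '' ({τ : ℍ | h τ = 0} ∩ K) with hF₁
  have hF₁fin : F₁.Finite := hZfin.image Ψ
  set S' : Set ℂ := {w | ∃ x ∈ F₁, w - x ∈ Λ} with hS'
  have hS'count : S'.Countable := by
    have : S' = ⋃ x ∈ F₁, (fun l : ℂ ↦ x + l) '' (Λ : Set ℂ) := by
      ext w
      simp only [hS', mem_setOf_eq, mem_iUnion, mem_image, SetLike.mem_coe, exists_prop]
      constructor
      · rintro ⟨x, hx, hw⟩
        exact ⟨x, hx, w - x, hw, by ring⟩
      · rintro ⟨x, hx, l, hl, rfl⟩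
        exact ⟨x, hx, by simpa using hl⟩
    rw [this]
    exact hF₁fin.countable.biUnion fun x _ ↦ hΛcount.image _
  -- local constancy of the orbit count off `S'`
  have hmain : ∀ w₀, w₀ ∉ S' →
      Finite {y : MulAction.orbitRel.Quotient X.Gamma ℍ //
        ∃ τ : ℍ, Quotient.mk (MulAction.orbitRel X.Gamma ℍ) τ = y ∧ Ψ τ - w₀ ∈ Λ} ∧
      ∀ᶠ w in 𝓝 w₀,
        Nat.card {y : MulAction.orbitRel.Quotient X.Gamma ℍ //
          ∃ τ : ℍ, Quotient.mk (MulAction.orbitRel X.Gamma ℍ) τ = y ∧ Ψ τ - w ∈ Λ} =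
        Nat.card {y : MulAction.orbitRel.Quotient X.Gamma ℍ //
          ∃ τ : ℍ, Quotient.mk (MulAction.orbitRel X.Gamma ℍ) τ = y ∧ Ψ τ - w₀ ∈ Λ} := by
    intro w₀ hw₀
    have hw₀' : ∀ x ∈ F₁, w₀ - x ∉ Λ := fun x hx h ↦ hw₀ ⟨x, hx, h⟩
    have hred : ∀ᶠ w in 𝓝 w₀, ∀ τ : ℍ, Ψ τ - w ∈ Λ → ∃ γ ∈ X.Gamma, γ • τ ∈ K :=
      Filter.Eventually.of_forall fun w τ _ ↦ hKcov τ
    refine finite_and_eventually_natCard_fiberOrbits_eq hΨc hΛc hr hrΛ hΨΓ hK hred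
      fun τ hτK hτ ↦ hloc τ ?_
    intro hhτ
    apply hw₀' (Ψ τ) ⟨τ, ⟨hhτ, hτK⟩, rfl⟩
    simpa using Λ.neg_mem hτ
  -- the count as a function, constant on the connected set `S'ᶜ`
  set n : ℂ → ℕ := fun w ↦ Nat.card {y : MulAction.orbitRel.Quotient X.Gamma ℍ //
      ∃ τ : ℍ, Quotient.mk (MulAction.orbitRel X.Gamma ℍ) τ = y ∧ Ψ τ - w ∈ Λ} with hn
  have hconst : ∀ w ∈ S'ᶜ, ∀ w' ∈ S'ᶜ, n w = n w' := by
    have hconn : IsConnected S'ᶜ :=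
      hS'count.isConnected_compl_of_one_lt_rank (by rw [Complex.rank_real_complex]; norm_num)
    haveI := Subtype.preconnectedSpace hconn.isPreconnected
    have hlc : IsLocallyConstant (fun x : ↥(S'ᶜ) ↦ n x) := by
      refine (IsLocallyConstant.iff_eventually_eq _).mpr fun x ↦ ?_
      exact continuous_subtype_val.continuousAt.eventually (hmain x.1 x.2).2
    intro w hw w' hw'
    have h := congr_fun (hlc.eq_const ⟨w, hw⟩) ⟨w', hw'⟩
    simp only [const_apply] at h
    exact h.symm
  -- a base point `w₁ ∉ S'` in the image of `Ψ`: there `n w₁ ≥ 1`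
  obtain ⟨τ₁, hτ₁⟩ : ∃ τ₁ : ℍ, h τ₁ ≠ 0 := by
    by_contra hc
    simp only [not_exists, not_not] at hc
    exact hh (funext hc)
  obtain ⟨w₁, hw₁S, σ₁, -, hσ₁⟩ : (S'ᶜ ∩ Ψ '' univ).Nonempty :=
    (hS'count.dense_compl ℝ).inter_nhds_nonempty ((hloc τ₁ hτ₁).2 (image_mem_map univ_mem))
  have hd : 0 < n w₁ := by
    haveI := (hmain w₁ hw₁S).1
    refine Nat.card_pos_iff.mpr ⟨⟨⟨Quotient.mk _ σ₁, σ₁, rfl, ?_⟩⟩, inferInstance⟩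
    simp [hσ₁, Λ.zero_mem]
  -- conclusion
  refine ⟨n w₁, hd, (hF₁fin.image (QuotientAddGroup.mk : ℂ → ℂ ⧸ Λ)).subset ?_⟩
  intro P hP
  by_contra hPF
  obtain ⟨w, rfl⟩ := QuotientAddGroup.mk_surjective P
  have hwS : w ∈ S'ᶜ := by
    rintro ⟨x, hx, hwx⟩
    exact hPF ⟨x, hx, (QuotientAddGroup.eq_iff_sub_mem.mpr hwx).symm⟩
  apply hP
  rw [← hconst w hwS w₁ hw₁S, hn]
  refine Nat.card_congr (Equiv.subtypeEquivRight fun y ↦ ?_)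
  simp only [QuotientAddGroup.eq_iff_sub_mem]

end ShimuraCurveData

/-! ### The automorphic half for `D > 1` from an eigenform with periods in the Néron lattice -/

open Literature.NumberTheory.EllipticCurves.ModularForms (IsNeronLatticeOf) in
/-- **The `D > 1` part of `nonempty_shimuraParametrizationData` from its arithmetic content
alone.** Suppose (`hJL`) that for every admissible `N = D M` with `1 < D`, every datum `X` of level
`(D, M)`, every globally minimal elliptic `W/ℚ` of conductor `N` and every Néron-type period pair
`L` of `W` there is a NON-ZERO `h ∈ S₂(Γ₀^D(M))` with periods in `Λ_L` and `T_ℓ h = a_ℓ(W) h` for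
primes `ℓ ∤ D M` — the Jacquet–Langlands transfer of the newform of `W` (Pasten §2 p. 12, §4.10
p. 16) scaled into the Hecke line of `φ_{D,M}^•(du)` (Shimura's construction `q_{D,M}` and an
isogeny `A_{D,M} → W`, §4.11 and Prop. 5.1). Then the automorphic half of the fact holds at every
such `(N, D, M)`: the degree `d ≥ 1` and the cofinite fibre count are supplied by
`ShimuraCurveData.exists_deg_of_hasPeriodsIn` (compactness of `X₀^D(M)(ℂ)`). Together with the
`D = 1` case this is the right-hand side of
`nonempty_shimuraParametrizationData_iff_automorphicHalf`.
[cite: PastenShimura2024, §2 p. 12 and §4.10–4.11 p. 16 and Prop. 5.1 p. 17] -/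
theorem automorphicHalf_of_eigenform_of_one_lt
    (hJL : ∀ {N D M : ℕ}, IsAdmissibleFactorization N D M → 1 < D →
      ∀ (X : ShimuraCurveData D M) (W : WeierstrassCurve ℚ) [W.IsElliptic] [W.IsGloballyMinimal],
        W.conductorNorm ℤ = N → ∀ {L : PeriodPair}, IsNeronLatticeOf (W.baseChange ℂ) L →
        ∃ h : CuspForm X.Gamma 2, (⇑h : ℍ → ℂ) ≠ 0 ∧
          HasPeriodsIn X.Gamma h (L.lattice : Set ℂ) ∧
          ∀ ℓ : ℕ, ℓ.Prime → ¬ ℓ ∣ D * M →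
            X.heckeFun ℓ h = fun τ => ((W.LFunction ℓ : ℤ) : ℂ) * h τ)
    {N D M : ℕ} (hNDM : IsAdmissibleFactorization N D M) (hD : 1 < D)
    (X : ShimuraCurveData D M) (W : WeierstrassCurve ℚ) [W.IsElliptic] [W.IsGloballyMinimal]
    (hN : W.conductorNorm ℤ = N) {L : PeriodPair} (hL : IsNeronLatticeOf (W.baseChange ℂ) L) :
    ∃ (h : CuspForm X.Gamma 2) (τ₀ : ℍ) (d : ℕ),
      HasPeriodsIn X.Gamma h (L.lattice : Set ℂ) ∧
      (∀ ℓ : ℕ, ℓ.Prime → ¬ ℓ ∣ D * M →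
        X.heckeFun ℓ h = fun τ => ((W.LFunction ℓ : ℤ) : ℂ) * h τ) ∧
      0 < d ∧
      {c : ℂ ⧸ L.lattice.toAddSubgroup |
        Nat.card {y : MulAction.orbitRel.Quotient X.Gamma ℍ // ∃ τ : ℍ,
          (Quotient.mk _ τ : MulAction.orbitRel.Quotient X.Gamma ℍ) = y ∧
            ((segmentIntegral h τ₀ τ : ℂ) : ℂ ⧸ L.lattice.toAddSubgroup) = c} ≠ d}.Finite := by
  obtain ⟨h, hh, hper, hhecke⟩ := hJL hNDM hD X W hN hL
  obtain ⟨d, hd, hfin⟩ := X.exists_deg_of_hasPeriodsIn hD h hh L hper UpperHalfPlane.I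
  exact ⟨h, UpperHalfPlane.I, d, hper, hhecke, hd, hfin⟩

open Literature.NumberTheory.EllipticCurves.ModularForms (IsNeronLatticeOf) in
/-- **`nonempty_shimuraParametrizationData` from the `D = 1` automorphic half and, for `D > 1`,
a Jacquet–Langlands eigenform with periods in the Néron lattice.** The two hypotheses are the
right-hand side of `nonempty_shimuraParametrizationData_iff_automorphicHalf` at `D = 1` (the
modular curve `X₀(N)`: Modularity + Eichler–Shimura + Faltings + the degree of `X₀(N) → ℂ/Λ`, cf.
the tree's `nonempty_modularParametrizationData`) and, at `D > 1`, only the existence of a non-zero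
eigenform with the right periods (`automorphicHalf_of_eigenform_of_one_lt`); the degree clause for
`D > 1` is now a theorem.
[cite: PastenShimura2024, §2 p. 12 and §4.10–4.11 p. 16 and Prop. 5.1 p. 17] -/
theorem nonempty_shimuraParametrizationData_of_one_and_eigenform
    (h₁ : ∀ {N M : ℕ}, IsAdmissibleFactorization N 1 M →
      ∀ (X : ShimuraCurveData 1 M) (W : WeierstrassCurve ℚ) [W.IsElliptic] [W.IsGloballyMinimal],
        W.conductorNorm ℤ = N → ∀ {L : PeriodPair}, IsNeronLatticeOf (W.baseChange ℂ) L →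
        ∃ (h : CuspForm X.Gamma 2) (τ₀ : ℍ) (d : ℕ),
          HasPeriodsIn X.Gamma h (L.lattice : Set ℂ) ∧
          (∀ ℓ : ℕ, ℓ.Prime → ¬ ℓ ∣ 1 * M →
            X.heckeFun ℓ h = fun τ => ((W.LFunction ℓ : ℤ) : ℂ) * h τ) ∧
          0 < d ∧
          {c : ℂ ⧸ L.lattice.toAddSubgroup |
            Nat.card {y : MulAction.orbitRel.Quotient X.Gamma ℍ // ∃ τ : ℍ,
              (Quotient.mk _ τ : MulAction.orbitRel.Quotient X.Gamma ℍ) = y ∧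
                ((segmentIntegral h τ₀ τ : ℂ) : ℂ ⧸ L.lattice.toAddSubgroup) = c} ≠ d}.Finite)
    (hJL : ∀ {N D M : ℕ}, IsAdmissibleFactorization N D M → 1 < D →
      ∀ (X : ShimuraCurveData D M) (W : WeierstrassCurve ℚ) [W.IsElliptic] [W.IsGloballyMinimal],
        W.conductorNorm ℤ = N → ∀ {L : PeriodPair}, IsNeronLatticeOf (W.baseChange ℂ) L →
        ∃ h : CuspForm X.Gamma 2, (⇑h : ℍ → ℂ) ≠ 0 ∧
          HasPeriodsIn X.Gamma h (L.lattice : Set ℂ) ∧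
          ∀ ℓ : ℕ, ℓ.Prime → ¬ ℓ ∣ D * M →
            X.heckeFun ℓ h = fun τ => ((W.LFunction ℓ : ℤ) : ℂ) * h τ) :
    nonempty_shimuraParametrizationData := by
  refine nonempty_shimuraParametrizationData_of_automorphicHalf
    fun {N D M} hNDM X W _ _ hN {L} hL => ?_
  rcases Nat.lt_or_ge 1 D with hD | hD
  · exact automorphicHalf_of_eigenform_of_one_lt hJL hNDM hD X W hN hL
  · obtain rfl : D = 1 := le_antisymm hD hNDM.pos_left
    exact h₁ hNDM X W hN hL

end Literature.NumberTheory.Automorphic
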